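import Literature.NumberTheory.EllipticCurves.Greenberg1999.TwoTorsionIsogenyDiscriminantSignProofs
import HarnessLib

/-!
# Greenberg's configurations under an admissible quadratic twist, continued: «co-odd» and «middle», the
# sign of `Δ`, and the four `ℤ/2`-linked PAIR TYPES — a negative twist swaps the two types with both
# discriminants positive (proofs only)

Topic `NumberTheory/EllipticCurves/Greenberg1999`; theorem-only companion (no definition, no named fact, no instance,
no `sorry`) of `TwoTorsionQuadraticTwistConfigurationProofs` (ramified / odd under twist),
`TwoTorsionOddCriterionProofs` (the exact sign tests) and `TwoTorsionIsogenyDiscriminantSignProofs` (sign of `Δ`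
along the pair).  Greenberg, LNM 1716 §5 (Props. 5.13, 5.14 and the Remarks pp. 121–124): for a rational point
`P` of order `2` the conditions «`⟨P⟩` ramified at `2`» and «`⟨P⟩` odd» decide `μ`; a quadratic twist `E^{(d)}`
by `d` prime to `2` carries `P` to a rational `2`-torsion point `P^{(d)}` of `E^{(d)}`.

Setting as in the siblings: `W/ℚ` with a rational point `P = (C.r, C.t)` of order `2` exhibited by a two-torsion
normal form `C • W`; a model `A` of the twist, `C_A • A = W^{(d)}`; the twisted point has abscissa
`x_A = u_A² (d · C.r) + r_A` on `A`.  «odd» = `x(P)` is the LEAST real root of the `2`-division cubic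
(`TwoTorsionOdd`), «co-odd» = it is the LARGEST (`∀ r, cubic r = 0 → r ≤ x(P)`), «middle» = neither.

**Theorems.**
* §1 `forall_root_le_quadraticTwist_iff_of_pos` / `_of_neg` — `d > 0`: co-odd ↦ co-odd; `d < 0`: co-odd(`P^{(d)}`)
  ⟺ odd(`P`) (companion of `twoTorsionOdd_quadraticTwist_iff_of_neg`: odd(`P^{(d)}`) ⟺ co-odd(`P`));
  `middle_quadraticTwist_iff` — «middle» is invariant under EVERY twist `d ≠ 0`.
* §2 `Δ_pos_iff_of_smul_eq_quadraticTwist`, `Δ_neg_iff_of_smul_eq_quadraticTwist` — `sign Δ(A) = sign Δ(W)`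
  (`Δ(W^{(d)}) = d⁶ Δ(W)`).
* §3 The dual link of a `ℤ/2`-linked pair (`smul_eq_twoIsogenyCodomain_partner`: `(W', P') ↦ (W, P)` is again a
  `ℤ/2`-linked pair) and **`Δ_neg_iff_partner_middle`: `Δ(W) < 0` iff `P'` is the middle point of `W'`**,
  `Δ_pos_iff_partner_odd_or_coodd`.
* §4 **The four pair types and their twists.**  On a pair with `a₁` odd on both minimal models (good-ordinary or
  multiplicative at `2`): a Prop-5.13 point `P` (ramified AND odd) on `W` has partner `P'` «neither», and EITHER
  `Δ(W) < 0` (type R₁: `P'` middle) OR `Δ(W) > 0` (type R₂: `P'` co-odd, `Δ(W') > 0`)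
  (`partner_middle_or_coodd_of_ramified_odd`); a ramified Prop-5.14 point (ramified, not odd) is EITHER middle
  (type M₁: `Δ(W') < 0`) OR co-odd (type M₂: `Δ(W') > 0`).  Under a twist by `d < 0`, `v₂(d) = 0`, between minimal
  models with `a₁` odd: **a ramified co-odd point becomes ramified AND odd** (`ramified_and_odd_twist_of_neg_of_ramified_coodd`:
  M₂ ↦ R₂, Prop 5.13's hypothesis appears) and **a Prop-5.13 point with `Δ(W) > 0` becomes ramified, co-odd and NOT odd**
  (`prop514Hypothesis_twist_of_neg_of_ramified_odd_of_Δ_pos`: R₂ ↦ M₂, Prop 5.14's hypothesis appears); types R₁ / M₁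
  (a member with `Δ < 0`, or a middle point) are invariant under every admissible twist
  (`ramified_and_odd_twist_iff_of_Δ_neg`, `middle_quadraticTwist_iff`), and `d > 0` preserves everything
  (`configuration_quadraticTwist_of_pos` of the sibling).

Written for the BSD cell `bsd-2adic` (S3/K4 stratum (β): which sub-pieces of «`E(ℚ)[2] ≠ 0`» are closed under the
admissible twists `d ≡ 1 (mod 4)` of Smith's head line).  Nothing about `μ`, `λ` or BSD is claimed here.

## References
* [GreenbergLNM1716] R. Greenberg, *Iwasawa theory for elliptic curves*, LNM 1716 (1999), §5 Props. 5.13–5.14 and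
  Remarks (chunks p0168–p0174).
* [SilvermanAEC2009] J. H. Silverman, *AEC*, III.1 Table 3.1, III.4 Example 4.5, X.5 Cor. 5.4.
-/

set_option autoImplicit false

open WeierstrassCurve

namespace Literature.NumberTheory.EllipticCurves.Greenberg1999

/-! ### §1. «Co-odd» and «middle» under twist -/

section CooddTwist

variable (W A : WeierstrassCurve ℚ) [W.IsElliptic] [A.IsElliptic] (C C_A : VariableChange ℚ) (d : ℚ)

omit [W.IsElliptic] [A.IsElliptic] in
/-- The twisted normal form's invariants: `a₂((C•W)^d) = d·a₂(C•W)`, `a₄((C•W)^d) = d²·a₄(C•W)`, read on the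
model `A` through `C'' = (u, d·r, 0, 0) * C_A`. [cite: SilvermanAEC2009, III.1 Table 3.1 and X.5 Cor. 5.4] -/
theorem twistChange_a₂_a₄ [(C • W).IsTwoTorsionNF] (hA : C_A • A = W.quadraticTwist d) :
    (((⟨C.u, d * C.r, 0, 0⟩ : VariableChange ℚ) * C_A) • A).a₂ = d * (C • W).a₂ ∧
      (((⟨C.u, d * C.r, 0, 0⟩ : VariableChange ℚ) * C_A) • A).a₄ = d ^ 2 * (C • W).a₄ := by
  rw [twistChange_smul_eq W A C C_A d hA]
  exact ⟨quadraticTwist_a₂_of_isTwoTorsionNF d (C • W) four_ne_zero,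
    quadraticTwist_a₄_of_isTwoTorsionNF d (C • W) two_ne_zero⟩

/-- **Positive twist preserves «co-odd»**: for `d > 0` the twisted point is the largest real `2`-torsion abscissa
of `A` iff `P` is the largest one of `W`. [cite: GreenbergLNM1716, §5 Remark (chunk p0174)] -/
theorem forall_root_le_quadraticTwist_iff_of_pos [(C • W).IsTwoTorsionNF] (hA : C_A • A = W.quadraticTwist d)
    (hd : 0 < d) :
    (∀ r : ℝ, 4 * r ^ 3 + (A.b₂ : ℝ) * r ^ 2 + 2 * (A.b₄ : ℝ) * r + (A.b₆ : ℝ) = 0 →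
        r ≤ (((C_A.u : ℚ) ^ 2 * (d * C.r) + C_A.r : ℚ) : ℝ)) ↔
      ∀ r : ℝ, 4 * r ^ 3 + (W.b₂ : ℝ) * r ^ 2 + 2 * (W.b₄ : ℝ) * r + (W.b₆ : ℝ) = 0 → r ≤ (C.r : ℝ) := by
  set C'' : VariableChange ℚ := (⟨C.u, d * C.r, 0, 0⟩ : VariableChange ℚ) * C_A with hC''
  haveI hNF'' : (C'' • A).IsTwoTorsionNF := by
    rw [hC'', twistChange_smul_eq W A C C_A d hA]; exact isTwoTorsionNF_quadraticTwist d (C • W)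
  have hr : C''.r = (C_A.u : ℚ) ^ 2 * (d * C.r) + C_A.r := by rw [hC'']; exact twistChange_r C C_A d
  obtain ⟨ha₂, ha₄⟩ := twistChange_a₂_a₄ W A C C_A d hA
  rw [← hC''] at ha₂ ha₄
  rw [← hr, forall_root_le_iff_sign A C'', forall_root_le_iff_sign W C]
  obtain ⟨hbA, -, hposA, hDA⟩ := sign_nf_iff_sign A C''
  obtain ⟨hbW, -, hposW, hDW⟩ := sign_nf_iff_sign W C
  rw [← hbA, ← hposA, ← hDA, ← hbW, ← hposW, ← hDW, ha₂, ha₄]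
  have hd2 : 0 < d ^ 2 := by positivity
  have e1 : (d * (C • W).a₂) ^ 2 = d ^ 2 * (C • W).a₂ ^ 2 := by ring
  have e2 : 4 * (d ^ 2 * (C • W).a₄) = d ^ 2 * (4 * (C • W).a₄) := by ring
  rw [e1, e2]
  exact and_congr (mul_pos_iff_of_pos_left hd2) (or_congr (mul_pos_iff_of_pos_left hd)
    ⟨fun h ↦ lt_of_mul_lt_mul_left h hd2.le, fun h ↦ mul_lt_mul_of_pos_left h hd2⟩)

/-- **Negative twist turns «co-odd» into «odd»**: for `d < 0` the twisted point is the LARGEST real `2`-torsion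
abscissa of `A` iff `P` is the LEAST one of `W` (companion of `twoTorsionOdd_quadraticTwist_iff_of_neg`).
[cite: GreenbergLNM1716, §5 Remark (chunk p0174)] -/
theorem forall_root_le_quadraticTwist_iff_of_neg [(C • W).IsTwoTorsionNF] (hA : C_A • A = W.quadraticTwist d)
    (hd : d < 0) :
    (∀ r : ℝ, 4 * r ^ 3 + (A.b₂ : ℝ) * r ^ 2 + 2 * (A.b₄ : ℝ) * r + (A.b₆ : ℝ) = 0 →
        r ≤ (((C_A.u : ℚ) ^ 2 * (d * C.r) + C_A.r : ℚ) : ℝ)) ↔ TwoTorsionOdd W C.r := by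
  set C'' : VariableChange ℚ := (⟨C.u, d * C.r, 0, 0⟩ : VariableChange ℚ) * C_A with hC''
  haveI hNF'' : (C'' • A).IsTwoTorsionNF := by
    rw [hC'', twistChange_smul_eq W A C C_A d hA]; exact isTwoTorsionNF_quadraticTwist d (C • W)
  have hr : C''.r = (C_A.u : ℚ) ^ 2 * (d * C.r) + C_A.r := by rw [hC'']; exact twistChange_r C C_A d
  obtain ⟨ha₂, ha₄⟩ := twistChange_a₂_a₄ W A C C_A d hA
  rw [← hC''] at ha₂ ha₄
  rw [← hr, forall_root_le_iff_sign A C'', twoTorsionOdd_iff_sign W C]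
  obtain ⟨hbA, -, hposA, hDA⟩ := sign_nf_iff_sign A C''
  obtain ⟨hbW, hnegW, -, hDW⟩ := sign_nf_iff_sign W C
  rw [← hbA, ← hposA, ← hDA, ← hbW, ← hnegW, ← hDW, ha₂, ha₄]
  have hd2 : 0 < d ^ 2 := by rw [sq]; exact mul_pos_of_neg_of_neg hd hd
  have e1 : (d * (C • W).a₂) ^ 2 = d ^ 2 * (C • W).a₂ ^ 2 := by ring
  have e2 : 4 * (d ^ 2 * (C • W).a₄) = d ^ 2 * (4 * (C • W).a₄) := by ring
  have e3 : (0 < d * (C • W).a₂) ↔ (C • W).a₂ < 0 := by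
    constructor
    · intro h; by_contra h'; exact absurd h (not_lt.mpr (mul_nonpos_of_nonpos_of_nonneg hd.le (not_lt.mp h')))
    · intro h; exact mul_pos_of_neg_of_neg hd h
  rw [e1, e2]
  exact and_congr (mul_pos_iff_of_pos_left hd2) (or_congr e3
    ⟨fun h ↦ lt_of_mul_lt_mul_left h hd2.le, fun h ↦ mul_lt_mul_of_pos_left h hd2⟩)

/-- **«Middle» is invariant under every twist** (`d ≠ 0`): the twisted point is neither the least nor the largest
real `2`-torsion abscissa of `A` iff `P` is neither on `W` (for `d < 0` the two extreme positions are exchanged).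
[cite: GreenbergLNM1716, §5 Remark (chunk p0174)] -/
theorem middle_quadraticTwist_iff [(C • W).IsTwoTorsionNF] (hA : C_A • A = W.quadraticTwist d) (hd0 : d ≠ 0) :
    (¬ TwoTorsionOdd A ((C_A.u : ℚ) ^ 2 * (d * C.r) + C_A.r) ∧
      ¬ ∀ r : ℝ, 4 * r ^ 3 + (A.b₂ : ℝ) * r ^ 2 + 2 * (A.b₄ : ℝ) * r + (A.b₆ : ℝ) = 0 →
        r ≤ (((C_A.u : ℚ) ^ 2 * (d * C.r) + C_A.r : ℚ) : ℝ)) ↔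
      (¬ TwoTorsionOdd W C.r ∧
        ¬ ∀ r : ℝ, 4 * r ^ 3 + (W.b₂ : ℝ) * r ^ 2 + 2 * (W.b₄ : ℝ) * r + (W.b₆ : ℝ) = 0 → r ≤ (C.r : ℝ)) := by
  rcases lt_or_gt_of_ne hd0 with hd | hd
  · rw [twoTorsionOdd_quadraticTwist_iff_of_neg W A C C_A d hA hd,
      forall_root_le_quadraticTwist_iff_of_neg W A C C_A d hA hd, and_comm]
  · rw [twoTorsionOdd_quadraticTwist_iff_of_pos W A C C_A d hA hd,
      forall_root_le_quadraticTwist_iff_of_pos W A C C_A d hA hd]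

end CooddTwist

/-! ### §2. The sign of `Δ` is a twist invariant -/

section DeltaTwist

variable (W A : WeierstrassCurve ℚ) (C_A : VariableChange ℚ) (d : ℚ)

/-- **`sign Δ(A) = sign Δ(W)`** for any model `A` of the twist (`Δ(W^{(d)}) = d⁶ Δ(W)`, `Δ(C • A) = u⁻¹² Δ(A)`).
[cite: SilvermanAEC2009, III.1 Table 3.1 and X.5 Cor. 5.4] -/
theorem Δ_pos_iff_of_smul_eq_quadraticTwist (hA : C_A • A = W.quadraticTwist d) (hd0 : d ≠ 0) :
    0 < A.Δ ↔ 0 < W.Δ := by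
  rw [← Δ_smul_pos_iff A C_A, hA, quadraticTwist_Δ]
  have hd6 : 0 < d ^ 6 := by
    rw [show (6 : ℕ) = 2 * 3 by norm_num, pow_mul]; positivity
  exact mul_pos_iff_of_pos_left hd6

/-- `Δ(A) < 0 ⟺ Δ(W) < 0`. [cite: SilvermanAEC2009, III.1 Table 3.1 and X.5 Cor. 5.4] -/
theorem Δ_neg_iff_of_smul_eq_quadraticTwist (hA : C_A • A = W.quadraticTwist d) (hd0 : d ≠ 0) :
    A.Δ < 0 ↔ W.Δ < 0 := by
  rw [← Δ_smul_neg_iff A C_A, hA, quadraticTwist_Δ]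
  have hd6 : 0 < d ^ 6 := by
    rw [show (6 : ℕ) = 2 * 3 by norm_num, pow_mul]; positivity
  constructor
  · intro h; by_contra h'; exact absurd h (not_lt.mpr (mul_nonneg hd6.le (not_lt.mp h')))
  · intro h; exact mul_neg_of_pos_of_neg hd6 h

end DeltaTwist

/-! ### §3. The dual link: `Δ(W) < 0` iff the partner's point is the middle one -/

section DualLink

variable (W W' : WeierstrassCurve ℚ) [W.IsElliptic] [W'.IsElliptic] (C C' : VariableChange ℚ)

omit [W'.IsElliptic] in
/-- **The dual link**: if `C' • W' = (C • W)'` then `((2,0,0,0)⁻¹ * C) • W = (C' • W')'` — the pair read from the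
other side is again a `ℤ/2`-linked pair, with the SAME abscissa `C.r` for `P` (the scaling `(2,0,0,0)` carries the
codomain of the dual `2`-isogeny back onto the normal form, *AEC* III.6.1). [cite: SilvermanAEC2009, III.4 Example 4.5 and III.6.1] -/
theorem smul_eq_twoIsogenyCodomain_partner [(C • W).IsTwoTorsionNF] (hlink : C' • W' = (C • W).twoIsogenyCodomain) :
    ((⟨Units.mk0 (2 : ℚ) two_ne_zero, 0, 0, 0⟩ : VariableChange ℚ)⁻¹ * C) • W =
        (C' • W').twoIsogenyCodomain ∧
      ((⟨Units.mk0 (2 : ℚ) two_ne_zero, 0, 0, 0⟩ : VariableChange ℚ)⁻¹ * C).r = C.r := by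
  refine ⟨?_, ?_⟩
  · have h := two_smul_twoIsogenyCodomain_twoIsogenyCodomain (C • W)
    rw [mul_smul, hlink]
    conv_lhs => rw [← h]
    rw [inv_smul_smul]
  · rw [VariableChange.mul_def]
    simp [VariableChange.inv_def]

/-- **`Δ(W) < 0` iff `P'` is the MIDDLE real `2`-torsion point of `W'`** (the dual of `Δ_partner_neg_iff_middle`).
[cite: GreenbergLNM1716, §5 Remark (chunks p0170, p0174)] -/
theorem Δ_neg_iff_partner_middle [(C • W).IsTwoTorsionNF] (hlink : C' • W' = (C • W).twoIsogenyCodomain) :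
    W.Δ < 0 ↔ (¬ TwoTorsionOdd W' C'.r ∧
      ¬ ∀ r : ℝ, 4 * r ^ 3 + (W'.b₂ : ℝ) * r ^ 2 + 2 * (W'.b₄ : ℝ) * r + (W'.b₆ : ℝ) = 0 → r ≤ (C'.r : ℝ)) := by
  haveI : (C' • W').IsTwoTorsionNF := by rw [hlink]; infer_instance
  obtain ⟨hlink', -⟩ := smul_eq_twoIsogenyCodomain_partner W W' C C' hlink
  exact Δ_partner_neg_iff_middle W' W C' _ hlink'

/-- **`Δ(W) > 0` iff `P'` is an EXTREME point of `W'`** (odd or co-odd). [cite: GreenbergLNM1716, §5 Remark (chunks p0170, p0174)] -/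
theorem Δ_pos_iff_partner_odd_or_coodd [(C • W).IsTwoTorsionNF] (hlink : C' • W' = (C • W).twoIsogenyCodomain) :
    0 < W.Δ ↔ (TwoTorsionOdd W' C'.r ∨
      ∀ r : ℝ, 4 * r ^ 3 + (W'.b₂ : ℝ) * r ^ 2 + 2 * (W'.b₄ : ℝ) * r + (W'.b₆ : ℝ) = 0 → r ≤ (C'.r : ℝ)) := by
  have hneg := Δ_neg_iff_partner_middle W W' C C' hlink
  have hΔ0 : W.Δ ≠ 0 := by rw [← W.coe_Δ']; exact W.Δ'.ne_zero
  constructor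
  · intro hpos
    by_contra h
    rw [not_or] at h
    exact absurd (hneg.mpr h) (not_lt.mpr hpos.le)
  · intro h
    rcases lt_trichotomy W.Δ 0 with hl | he | hg
    · obtain ⟨h1, h2⟩ := hneg.mp hl
      exact absurd h (not_or.mpr ⟨h1, h2⟩)
    · exact absurd he hΔ0
    · exact hg

end DualLink

/-! ### §4. The four pair types and their behaviour under twist -/

section PairTypes

variable (W W' : WeierstrassCurve ℚ) [W.IsElliptic] [W'.IsElliptic] (C C' : VariableChange ℚ)

/-- **A Prop-5.13 point's partner is «neither», and is the middle point iff `Δ(W) < 0`, co-odd iff `Δ(W) > 0`**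
(types R₁ / R₂ of a PURE pair; in both cases `Δ(W') > 0`).  Minimal models with `a₁` odd (good ordinary or
multiplicative at `2`). [cite: GreenbergLNM1716, §5 Props. 5.13–5.14 and Remarks (chunks p0168–p0174)] -/
theorem partner_middle_or_coodd_of_ramified_odd [W.IsGloballyMinimal] [W'.IsGloballyMinimal]
    (ha₁ : Odd (integralModelInt W).a₁) (ha₁' : Odd (integralModelInt W').a₁) [(C • W).IsTwoTorsionNF]
    (hlink : C' • W' = (C • W).twoIsogenyCodomain) (hR : TwoTorsionRamifiedAtTwo C.r) (hO : TwoTorsionOdd W C.r) :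
    0 < W'.Δ ∧ ¬ TwoTorsionRamifiedAtTwo C'.r ∧ ¬ TwoTorsionOdd W' C'.r ∧
      ((W.Δ < 0 ∧ ¬ ∀ r : ℝ, 4 * r ^ 3 + (W'.b₂ : ℝ) * r ^ 2 + 2 * (W'.b₄ : ℝ) * r + (W'.b₆ : ℝ) = 0 →
          r ≤ (C'.r : ℝ)) ∨
        (0 < W.Δ ∧ ∀ r : ℝ, 4 * r ^ 3 + (W'.b₂ : ℝ) * r ^ 2 + 2 * (W'.b₄ : ℝ) * r + (W'.b₆ : ℝ) = 0 →
          r ≤ (C'.r : ℝ))) := by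
  obtain ⟨hR', hO'⟩ := (ramified_and_odd_iff_neither_of_twoIsogeny W W' C C' ha₁ ha₁' hlink).mp ⟨hR, hO⟩
  refine ⟨Δ_partner_pos_of_twoTorsionOdd W W' C C' hlink hO, hR', hO', ?_⟩
  have hΔ0 : W.Δ ≠ 0 := by rw [← W.coe_Δ']; exact W.Δ'.ne_zero
  rcases lt_trichotomy W.Δ 0 with hl | he | hg
  · exact Or.inl ⟨hl, ((Δ_neg_iff_partner_middle W W' C C' hlink).mp hl).2⟩
  · exact absurd he hΔ0
  · exact Or.inr ⟨hg, ((Δ_pos_iff_partner_odd_or_coodd W W' C C' hlink).mp hg).resolve_left hO'⟩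

/-- **A ramified Prop-5.14 point (ramified, not odd) is the middle point iff `Δ(W') < 0`, co-odd iff `Δ(W') > 0`**
(types M₁ / M₂ of a MIXED pair, read at its ramified member; `Δ(W) > 0` in both cases since `Δ < 0` forces «odd»).
[cite: GreenbergLNM1716, §5 Props. 5.13–5.14 and Remarks (chunks p0168–p0174)] -/
theorem middle_or_coodd_of_ramified_not_odd [(C • W).IsTwoTorsionNF]
    (hlink : C' • W' = (C • W).twoIsogenyCodomain) (hO : ¬ TwoTorsionOdd W C.r) :
    0 < W.Δ ∧
      ((W'.Δ < 0 ∧ ¬ ∀ r : ℝ, 4 * r ^ 3 + (W.b₂ : ℝ) * r ^ 2 + 2 * (W.b₄ : ℝ) * r + (W.b₆ : ℝ) = 0 →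
          r ≤ (C.r : ℝ)) ∨
        (0 < W'.Δ ∧ ∀ r : ℝ, 4 * r ^ 3 + (W.b₂ : ℝ) * r ^ 2 + 2 * (W.b₄ : ℝ) * r + (W.b₆ : ℝ) = 0 →
          r ≤ (C.r : ℝ))) := by
  have hΔ0 : W.Δ ≠ 0 := by rw [← W.coe_Δ']; exact W.Δ'.ne_zero
  haveI : (C' • W').IsElliptic := by rw [hlink]; infer_instance
  have hΔ0' : W'.Δ ≠ 0 := by rw [← W'.coe_Δ']; exact W'.Δ'.ne_zero
  have hpos : 0 < W.Δ := by
    rcases lt_trichotomy W.Δ 0 with hl | he | hg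
    · exact absurd (twoTorsionOdd_smul_r_of_Δ_neg W C hl) hO
    · exact absurd he hΔ0
    · exact hg
  refine ⟨hpos, ?_⟩
  rcases lt_trichotomy W'.Δ 0 with hl | he | hg
  · exact Or.inl ⟨hl, ((Δ_partner_neg_iff_middle W W' C C' hlink).mp hl).2⟩
  · exact absurd he hΔ0'
  · refine Or.inr ⟨hg, ?_⟩
    by_contra hco
    exact absurd ((Δ_partner_neg_iff_middle W W' C C' hlink).mpr ⟨hO, hco⟩) (not_lt.mpr hg.le)

end PairTypes

section TwistTypes

variable (W A : WeierstrassCurve ℚ) [W.IsElliptic] [W.IsGloballyMinimal] [A.IsElliptic] [A.IsGloballyMinimal]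
  (C C_A : VariableChange ℚ) (d : ℚ)

/-- **M₂ ↦ R₂: a negative admissible twist turns a ramified CO-ODD point into a ramified ODD point** — Prop 5.13's
hypothesis APPEARS at the twist (both minimal models with `a₁` odd, `v₂(d) = 0`, `d < 0`).
[cite: GreenbergLNM1716, §5 Prop. 5.13 and Remark (chunks p0168, p0174)] -/
theorem ramified_and_odd_twist_of_neg_of_ramified_coodd (ha₁W : Odd (integralModelInt W).a₁)
    (ha₁A : Odd (integralModelInt A).a₁) [(C • W).IsTwoTorsionNF] (hA : C_A • A = W.quadraticTwist d)
    (hd : d < 0) (hd2 : padicValRat 2 d = 0) (hR : TwoTorsionRamifiedAtTwo C.r)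
    (hco : ∀ r : ℝ, 4 * r ^ 3 + (W.b₂ : ℝ) * r ^ 2 + 2 * (W.b₄ : ℝ) * r + (W.b₆ : ℝ) = 0 → r ≤ (C.r : ℝ)) :
    TwoTorsionRamifiedAtTwo ((C_A.u : ℚ) ^ 2 * (d * C.r) + C_A.r) ∧
      TwoTorsionOdd A ((C_A.u : ℚ) ^ 2 * (d * C.r) + C_A.r) := by
  obtain ⟨hram, hodd⟩ := configuration_quadraticTwist_of_neg W A C C_A d ha₁W ha₁A hA hd hd2
  exact ⟨hram.mpr hR, hodd.mpr hco⟩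

/-- **R₂ ↦ M₂: a negative admissible twist of a Prop-5.13 point with `Δ(W) > 0` is ramified, CO-ODD and NOT odd** —
Prop 5.14's hypothesis «ramified XOR odd» APPEARS at the twist, while Prop 5.13's disappears.
[cite: GreenbergLNM1716, §5 Props. 5.13–5.14 and Remark (chunks p0168–p0174)] -/
theorem prop514Hypothesis_twist_of_neg_of_ramified_odd_of_Δ_pos (ha₁W : Odd (integralModelInt W).a₁)
    (ha₁A : Odd (integralModelInt A).a₁) [(C • W).IsTwoTorsionNF] (hA : C_A • A = W.quadraticTwist d)
    (hd : d < 0) (hd2 : padicValRat 2 d = 0) (hΔ : 0 < W.Δ) (hR : TwoTorsionRamifiedAtTwo C.r)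
    (hO : TwoTorsionOdd W C.r) :
    TwoTorsionRamifiedAtTwo ((C_A.u : ℚ) ^ 2 * (d * C.r) + C_A.r) ∧
      ¬ TwoTorsionOdd A ((C_A.u : ℚ) ^ 2 * (d * C.r) + C_A.r) ∧
      ∀ r : ℝ, 4 * r ^ 3 + (A.b₂ : ℝ) * r ^ 2 + 2 * (A.b₄ : ℝ) * r + (A.b₆ : ℝ) = 0 →
        r ≤ (((C_A.u : ℚ) ^ 2 * (d * C.r) + C_A.r : ℚ) : ℝ) := by
  obtain ⟨hram, hodd⟩ := configuration_quadraticTwist_of_neg W A C C_A d ha₁W ha₁A hA hd hd2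
  have hco' := (forall_root_le_quadraticTwist_iff_of_neg W A C C_A d hA hd).mpr hO
  refine ⟨hram.mpr hR, fun hoddA ↦ ?_, hco'⟩
  -- `P` would be odd AND co-odd on `W`, impossible for `Δ(W) > 0`
  exact not_odd_and_coodd_of_Δ_pos W C hΔ ⟨hO, hodd.mp hoddA⟩

/-- **M₂'s unramified member ↦ «neither»**: a negative admissible twist of an UNRAMIFIED odd point with `Δ(W) > 0` is
unramified, co-odd and not odd («neither» — its own partner then carries the Prop-5.13 point).
[cite: GreenbergLNM1716, §5 Props. 5.13–5.14 and Remark (chunks p0168–p0174)] -/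
theorem neither_twist_of_neg_of_not_ramified_odd_of_Δ_pos (ha₁W : Odd (integralModelInt W).a₁)
    (ha₁A : Odd (integralModelInt A).a₁) [(C • W).IsTwoTorsionNF] (hA : C_A • A = W.quadraticTwist d)
    (hd : d < 0) (hd2 : padicValRat 2 d = 0) (hΔ : 0 < W.Δ) (hR : ¬ TwoTorsionRamifiedAtTwo C.r)
    (hO : TwoTorsionOdd W C.r) :
    ¬ TwoTorsionRamifiedAtTwo ((C_A.u : ℚ) ^ 2 * (d * C.r) + C_A.r) ∧
      ¬ TwoTorsionOdd A ((C_A.u : ℚ) ^ 2 * (d * C.r) + C_A.r) := by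
  obtain ⟨hram, hodd⟩ := configuration_quadraticTwist_of_neg W A C C_A d ha₁W ha₁A hA hd hd2
  exact ⟨fun h ↦ hR (hram.mp h), fun hoddA ↦ not_odd_and_coodd_of_Δ_pos W C hΔ ⟨hO, hodd.mp hoddA⟩⟩

/-- **R₁ is twist-stable: with `Δ(W) < 0`, Prop 5.13's hypothesis passes to EVERY admissible twist** (`d ≠ 0`,
`v₂(d) = 0`; the unique real `2`-torsion abscissa is both least and largest).
[cite: GreenbergLNM1716, §5 Prop. 5.13 and Remark (chunks p0168, p0170)] -/
theorem ramified_and_odd_twist_iff_of_Δ_neg (ha₁W : Odd (integralModelInt W).a₁)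
    (ha₁A : Odd (integralModelInt A).a₁) [(C • W).IsTwoTorsionNF] (hA : C_A • A = W.quadraticTwist d)
    (hd0 : d ≠ 0) (hd2 : padicValRat 2 d = 0) (hΔ : W.Δ < 0) :
    (TwoTorsionRamifiedAtTwo ((C_A.u : ℚ) ^ 2 * (d * C.r) + C_A.r) ∧
        TwoTorsionOdd A ((C_A.u : ℚ) ^ 2 * (d * C.r) + C_A.r)) ↔
      (TwoTorsionRamifiedAtTwo C.r ∧ TwoTorsionOdd W C.r) := by
  obtain ⟨hram, hoddA, hoddW⟩ := configuration_quadraticTwist_of_unique_real_root W A C C_A d ha₁W ha₁A hA hd0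
    hd2 (eq_of_twoDivision_root_of_Δ_neg W C hΔ)
  rw [hram]
  exact ⟨fun h ↦ ⟨h.1, hoddW⟩, fun h ↦ ⟨h.1, hoddA⟩⟩

/-- **Prop 5.14's hypothesis with `Δ(W) < 0` (type M₁'s unramified-odd member) passes to every admissible twist.**
[cite: GreenbergLNM1716, §5 Prop. 5.14 and Remark (chunks p0168, p0170)] -/
theorem prop514Hypothesis_twist_iff_of_Δ_neg (ha₁W : Odd (integralModelInt W).a₁)
    (ha₁A : Odd (integralModelInt A).a₁) [(C • W).IsTwoTorsionNF] (hA : C_A • A = W.quadraticTwist d)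
    (hd0 : d ≠ 0) (hd2 : padicValRat 2 d = 0) (hΔ : W.Δ < 0) :
    ((TwoTorsionRamifiedAtTwo ((C_A.u : ℚ) ^ 2 * (d * C.r) + C_A.r) ∧
          ¬ TwoTorsionOdd A ((C_A.u : ℚ) ^ 2 * (d * C.r) + C_A.r)) ∨
        (TwoTorsionOdd A ((C_A.u : ℚ) ^ 2 * (d * C.r) + C_A.r) ∧
          ¬ TwoTorsionRamifiedAtTwo ((C_A.u : ℚ) ^ 2 * (d * C.r) + C_A.r))) ↔
      ((TwoTorsionRamifiedAtTwo C.r ∧ ¬ TwoTorsionOdd W C.r) ∨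
        (TwoTorsionOdd W C.r ∧ ¬ TwoTorsionRamifiedAtTwo C.r)) := by
  obtain ⟨hram, hoddA, hoddW⟩ := configuration_quadraticTwist_of_unique_real_root W A C C_A d ha₁W ha₁A hA hd0
    hd2 (eq_of_twoDivision_root_of_Δ_neg W C hΔ)
  rw [hram]
  constructor
  · rintro (⟨_, h⟩ | ⟨_, h⟩)
    · exact absurd hoddA h
    · exact Or.inr ⟨hoddW, h⟩
  · rintro (⟨_, h⟩ | ⟨_, h⟩)
    · exact absurd hoddW h
    · exact Or.inr ⟨hoddA, h⟩

/-- **A ramified MIDDLE point (type M₁'s ramified member) keeps Prop 5.14's hypothesis under every admissible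
twist** («middle» and «ramified» are both twist invariants; a middle point is not odd).
[cite: GreenbergLNM1716, §5 Prop. 5.14 and Remark (chunks p0168, p0174)] -/
theorem ramified_not_odd_twist_of_ramified_middle (ha₁W : Odd (integralModelInt W).a₁)
    (ha₁A : Odd (integralModelInt A).a₁) [(C • W).IsTwoTorsionNF] (hA : C_A • A = W.quadraticTwist d)
    (hd0 : d ≠ 0) (hd2 : padicValRat 2 d = 0) (hR : TwoTorsionRamifiedAtTwo C.r) (hO : ¬ TwoTorsionOdd W C.r)
    (hco : ¬ ∀ r : ℝ, 4 * r ^ 3 + (W.b₂ : ℝ) * r ^ 2 + 2 * (W.b₄ : ℝ) * r + (W.b₆ : ℝ) = 0 → r ≤ (C.r : ℝ)) :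
    TwoTorsionRamifiedAtTwo ((C_A.u : ℚ) ^ 2 * (d * C.r) + C_A.r) ∧
      ¬ TwoTorsionOdd A ((C_A.u : ℚ) ^ 2 * (d * C.r) + C_A.r) ∧
      ¬ ∀ r : ℝ, 4 * r ^ 3 + (A.b₂ : ℝ) * r ^ 2 + 2 * (A.b₄ : ℝ) * r + (A.b₆ : ℝ) = 0 →
        r ≤ (((C_A.u : ℚ) ^ 2 * (d * C.r) + C_A.r : ℚ) : ℝ) := by
  have hram := twoTorsionRamifiedAtTwo_quadraticTwist_iff W A C C_A d ha₁W ha₁A hA hd2 hd0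
  obtain ⟨hO', hco'⟩ := (middle_quadraticTwist_iff W A C C_A d hA hd0).mpr ⟨hO, hco⟩
  exact ⟨hram.mpr hR, hO', hco'⟩

end TwistTypes

end Literature.NumberTheory.EllipticCurves.Greenberg1999
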